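/-
Copyright (c) 2026 the pub-hodgecm-mathlib formalisation cell (harness21).  Prover seat hodgecm-mathlib-K2E1-p16 (g3), Track B «K2-LIT» ENGINE E1, h413 = `stmt-HodgeConjecture-24833`,
route `HCCMUnconditional`, R90-S8 «ContSpec-n½», deal S8-R191 (2) (a′) (S8 dealer R90-CS-plan (g3)): «EVENTUAL `L²` BOUND ⇒ EVENTUAL POINTWISE BOUND» AT LEVEL — the continued
EIGEN-SMOOTHING identity of the level∕pair Eisenstein family of `U(2,1)` and the pointwise bound of `Ẽ(z)(g)` near a candidate pole from the `L²`-bound of its truncation.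
-/
import Summits.HodgeConjecture.HodgeConjecture.Theorems.K2E1ContinuedEisensteinHeckeConstantTermCMThree   -- ★ (K2E1-p10): `differentiableOn_integral_mul_continued_cm_three` (holomorphy of `z ↦ ∫ h(y)Ẽ(z)(gy)` under (E1)(E4)(E2-bd))
import Summits.HodgeConjecture.HodgeConjecture.Theorems.K2E1ChiEisensteinHeckeMatrixU2                      -- ★ `integral_mul_eisensteinSeriesU_flatSectionU_eq_cm_three` (`R(h)E(f_z^φ) = E(f_z^{T_{h,z}φ})` on the tube, every `h ∈ C_c`)
import Summits.HodgeConjecture.HodgeConjecture.Theorems.K2E1BLRemovablePolesU                               -- ★ `exists_bound_smoothing_truncation_of_isCompact` (the DOMINATION, rank-generic, every function), `eventually_norm_le_of_smul`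
import Summits.HodgeConjecture.HodgeConjecture.Theorems.K2E1ChiContinuedTruncationBoundedCMThree           -- ★ p863796 (this seat); brings ★ `truncation_rational_mul`
import Literature.NumberTheory.Automorphic.UnitaryGroupKernelDictionary                                     -- ★ `quotientSubgroup_quasiSplit` (`A_G·G(F) = G(F)` for the unitary datum)
import HarnessLib

/-!
# h413 ∕ R90-S8 (a′) — `K2E1EventualL2BoundPointwiseAtLevelCMThree`: «EVENTUAL `L²` BOUND ⇒ EVENTUAL POINTWISE BOUND» AT LEVEL — the eigen-smoothing identity
# `∫ h(y)·Ẽ(z)(g y) dν_G(y) = ŝ(z)·Ẽ(z)(g)` on the tube and continued, and `‖Ẽ(z)(g)‖ ≤ C` near `z₀` from `‖[Λ^T Ẽ(z)]‖_{L²(X)} ≤ C` near `z₀`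

Cell `pub/hodgecm-mathlib`, crux H413 = `stmt-HodgeConjecture-24833`; S8 dealer R90-CS-plan (g3), S8-R191 (2); census on the R90 bus 2026-09-05T01:03Z (the covering constant asked for is
★ already: `exists_bound_smoothing_truncation_of_isCompact`'s `C₀, T₀`).  Consumer: K2E2-p12 (g9)'s χ POLE LEDGER, row (a′) `hbdd` (pointwise boundedness of `Ẽ(z)(g)` near a fake pole
from the Maass–Selberg `L²` bound), at LEVEL — i.e. without the spherical Hecke relation.  THEOREMS ONLY (no `def`, no `instance`, no notation, no named-fact hypothesis, no `sorry`; default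
heartbeats); lane `--supports stmt-HodgeConjecture-24833 --as helper` (count-neutral).  Closes no socket.

THE MATHEMATICS ([MoeglinWaldspurger1995, IV.1.9, IV.3.12]; [BernsteinLapid2019, §4 Claim 1, p. 9–10]; [Garrett2018, §1.12, §2.10]).  The spherical road bounds `Ẽ(z)(g)` near a fake pole
through the HECKE relation `∫ h(y)Ẽ(z)(gy) dν_G = ĥ(z)Ẽ(z)(g)` (`h` bi-`K`-invariant) and the domination `‖∫ h(y)φ(gy)‖ ≤ C₀‖Λ^T φ‖_{L²(X)}` (★ rank-generic, for EVERY `φ`).  At LEVEL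
`(K′, ω)` the Eisenstein series is no Hecke eigenfunction for bi-`K`-invariant `h`, but the Bernstein–Lapid EIGEN package (★ exports' `hCD`: test functions `h_i = S_{η_i}η_i ∈ C_c(G(𝔸))`,
real, with `∫ h_i(y)·f_z^φ(x y) dν_G(y) = ŝ_i(z)·f_z^φ(x)` for `φ` in the section space — letter `hact` — and `ŝ_i(z₀) ≠ 0` for some `i` on every ball — `hcov`) provides the replacement:
* §1 **`integral_mul_eisensteinSeriesU_eq_of_eigen_cm_three`** (TUBE, `2 < Re z`): `∫ h(y)·E(f_z^φ)(g y) dν_G = s·E(f_z^φ)(g)` for an EIGEN-SECTION (`hact` at `z` with eigenvalue `s`): ★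
  `integral_mul_eisensteinSeriesU_flatSectionU_eq_cm_three` gives `E(f_z^{T_{h,z}φ})` with `T_{h,z}φ = (∫ h(y)f_z^φ(·y))·H^{−z} = s·φ` (`H^z·H^{−z} = 1`), and `E(f_z^{s•φ}) = s·E(f_z^φ)`.
* §2 **`integral_mul_continued_eq_of_tube_cm_three`** (CONTINUED): on an open preconnected `D` containing a neighbourhood of a real tube point `σ₀ > 2`, for a family `Ec` with the layer-2
  letters `hEd hE4 hEbd` on `D`, a coefficient `s` holomorphic on `D` and the tube identity on `D ∩ {2 < Re}`: `∫ h(y)·Ec z (g y) dν_G = s(z)·Ec z g` for ALL `z ∈ D` (both sides holomorphic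
  — ★ `differentiableOn_integral_mul_continued_cm_three` — identity theorem); **`integral_mul_continued_eq_of_eigen_cm_three`** — §1 ∘ §2 for the continued family of an eigen-section
  (`hE2 : Ec z = E(f_z^φ)` on the tube, `hact` on the tube).
* §3 **`eventually_norm_le_of_smoothing_L2Family_cm_three`** — (B) AT LEVEL in the operator-road currency: near `z₀`, on an eventual set `S` (e.g. `{1<Re} ∖ P`) where `Ec z` is left-`G(F)`-
  invariant and the smoothing identity holds with `s` continuous at `z₀`, `s(z₀) ≠ 0`: for every `g` there is Godement's threshold `T₀` such that for every level `T ≥ T₀` an `L²(μ)`-family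
  `Fam` a.e.-representing `Λ^T(Ec z)` on `S` with `‖Fam z‖ ≤ C` near `z₀` forces `‖Ec z g‖ ≤ C′` near `z₀` (★ domination on the compact `{g}` + ★ `eventually_norm_le_of_smul`).  The level `T` is
  free: (E6) of hCONT road C delivers `Fam_T` for EVERY `T ≥ 1` (★ p863881 level change).
HONEST LABEL: HC_CM is proved only modulo the 7 printed citations (2 remaining named inputs: hLiu418 = `stmt-HodgeConjecture-24832`, h413 = `stmt-HodgeConjecture-24833`) until rung 0
closes; this file asserts no named fact and closes no socket; its heads are CONDITIONAL on the named letters (`hact`∕`hE2`∕layer-2 letters∕`Fam`); count-neutral.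

## References
* [MoeglinWaldspurger1995] C. Mœglin, J.-L. Waldspurger, *Spectral Decomposition and Eisenstein Series* (1995), II.1.7, IV.1.9–IV.1.10, IV.3.12.
* [BernsteinLapid2019] J. Bernstein, E. Lapid, *On the meromorphic continuation of Eisenstein series*, J. Amer. Math. Soc. 37 (2024), §4 (Claim 1, pp. 9–10).
* [Garrett2018] P. Garrett, *Modern Analysis of Automorphic Forms by Example* (2018), §1.12, §2.10.
* [Langlands1976] R. P. Langlands, *On the Functional Equations Satisfied by Eisenstein Series*, LNM 544 (1976), §6 (p. 167).
-/

set_option autoImplicit false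
-- the mandated namespace repeats the single-problem summit's segment (`HodgeConjecture.HodgeConjecture`)
set_option linter.dupNamespace false

noncomputable section

open MeasureTheory Measure NumberField IsDedekindDomain Set Filter Topology
open scoped ENNReal NNReal
open Literature.NumberTheory.Automorphic Literature.NumberTheory.Automorphic.UnitaryGroup AdelicGroupData
open Summit.HodgeConjecture.HodgeConjecture.Cruxes.H413.K2E1BorelEisensteinU
open Summit.HodgeConjecture.HodgeConjecture.Cruxes.H413.K2E1BLRemovablePolesU (exists_bound_smoothing_truncation_of_isCompact eventually_norm_le_of_smul)
open Summit.HodgeConjecture.HodgeConjecture.Cruxes.H413.K2E1ChiEisensteinHeckeMatrixU2 (integral_mul_eisensteinSeriesU_flatSectionU_eq_cm_three)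
open Summit.HodgeConjecture.HodgeConjecture.Cruxes.H413.K2E1ContinuedEisensteinHeckeConstantTermCMThree (differentiableOn_integral_mul_continued_cm_three)

namespace Summit.HodgeConjecture.HodgeConjecture.Cruxes.H413.K2E1EventualL2BoundPointwiseAtLevelCMThree

variable (L : Type) [Field L] [NumberField L] [IsCMField L]
variable [MeasurableSpace (quasiSplit (↥(maximalRealSubfield L)) L (IsCMField.complexConj L) 3).Adelic] [BorelSpace (quasiSplit (↥(maximalRealSubfield L)) L (IsCMField.complexConj L) 3).Adelic]

/-! ## §1 The tube: an eigen-section gives an eigen-Eisenstein series for the smoothing operator -/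

section Tube

/-- **EIGEN-SMOOTHING ON THE TUBE**: for `2 < Re z`, `φ` continuous and bounded, `h ∈ C_c(G(𝔸))` and the EIGEN LETTER `hact : ∫ h(y)·f_z^φ(x y) dν_G(y) = s·f_z^φ(x)` (all `x`):
`∫ h(y)·E(f_z^φ)(g y) dν_G(y) = s·E(f_z^φ)(g)` for every `g` — ★ `integral_mul_eisensteinSeriesU_flatSectionU_eq_cm_three` (`R(h)E(f_z^φ) = E(f_z^{T_{h,z}φ})`, Godement range) with
`T_{h,z}φ = (∫ h(y)f_z^φ(·y))·H^{−z} = s·φ` and `E(f_z^{s•φ}) = s·E(f_z^φ)` (★ `eisensteinSeriesU_smul`). [cite: BernsteinLapid2019, §4 Claim 1 (p. 9)] [cite: MoeglinWaldspurger1995, II.1.7] -/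
theorem integral_mul_eisensteinSeriesU_eq_of_eigen_cm_three
    (νG : Measure (quasiSplit (↥(maximalRealSubfield L)) L (IsCMField.complexConj L) 3).Adelic) [νG.IsHaarMeasure]
    {h : (quasiSplit (↥(maximalRealSubfield L)) L (IsCMField.complexConj L) 3).Adelic → ℂ} (hh : Continuous h) (hhs : HasCompactSupport h)
    {φ : (quasiSplit (↥(maximalRealSubfield L)) L (IsCMField.complexConj L) 3).Adelic → ℂ} (hφc : Continuous φ) {M : ℝ} (hφM : ∀ x, ‖φ x‖ ≤ M) {z : ℂ} (hz : 2 < z.re) {s : ℂ}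
    (hact : ∀ x : (quasiSplit (↥(maximalRealSubfield L)) L (IsCMField.complexConj L) 3).Adelic, ∫ y, h y * flatSectionU φ z (x * y) ∂νG = s * flatSectionU φ z x)
    (g : (quasiSplit (↥(maximalRealSubfield L)) L (IsCMField.complexConj L) 3).Adelic) :
    ∫ y, h y * eisensteinSeriesU (flatSectionU φ z) (g * y) ∂νG = s * eisensteinSeriesU (flatSectionU φ z) g := by
  rw [integral_mul_eisensteinSeriesU_flatSectionU_eq_cm_three L νG hh hhs hφc hφM hz g]
  have hsec : flatSectionU (fun x => (∫ y, h y * flatSectionU φ z (x * y) ∂νG) * (((borelHeight x : ℝ≥0) : ℝ) : ℂ) ^ (-z)) z = s • flatSectionU φ z := by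
    funext x
    have hH : (((borelHeight x : ℝ≥0) : ℝ) : ℂ) ≠ 0 := by exact_mod_cast (borelHeight_pos x).ne'
    have hHz : (((borelHeight x : ℝ≥0) : ℝ) : ℂ) ^ z ≠ 0 := fun h0 => hH ((Complex.cpow_eq_zero_iff _ _).1 h0).1
    rw [Pi.smul_apply, smul_eq_mul, flatSectionU_apply, flatSectionU_apply, hact x, flatSectionU_apply, Complex.cpow_neg, mul_assoc, inv_mul_cancel₀ hHz, mul_one]
  rw [hsec, eisensteinSeriesU_smul]

end Tube

/-! ## §2 Continuation of the smoothing identity by the identity theorem -/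

section Continued

/-- **THE CONTINUED SMOOTHING IDENTITY, OF THE TUBE LETTER**: `h ∈ C_c(G(𝔸))` real, `ν_G` Haar; continued values `Ec` on an open preconnected `D` containing a neighbourhood of a real tube
point `σ₀ > 2`, with (E1) `hEd`, (E4) `hEc`, (E2-bd) `hEbd` on `D`; a coefficient `s` holomorphic on `D`; and the tube identity `∫ h(y)·Ec z (g y) dν_G = s(z)·Ec z g` for `z ∈ D`, `2 < Re z`.
THEN the identity holds for EVERY `z ∈ D` and `g`: both sides are holomorphic on `D` (★ `differentiableOn_integral_mul_continued_cm_three`) and agree near `σ₀`. (Twin of ★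
`integral_mul_continued_eq_cm_three`, `ĥ ↦ s`.) [cite: MoeglinWaldspurger1995, IV.1.9–IV.1.10] [cite: Langlands1976, §6 p. 167] [cite: BernsteinLapid2019, §4 (Claim 1(a))] -/
theorem integral_mul_continued_eq_of_tube_cm_three (νG : Measure (quasiSplit (↥(maximalRealSubfield L)) L (IsCMField.complexConj L) 3).Adelic) [νG.IsHaarMeasure]
    {h : (quasiSplit (↥(maximalRealSubfield L)) L (IsCMField.complexConj L) 3).Adelic → ℝ} (hhc : Continuous h) (hhs : HasCompactSupport h)
    (Ec : ℂ → (quasiSplit (↥(maximalRealSubfield L)) L (IsCMField.complexConj L) 3).Adelic → ℂ) {D : Set ℂ} (hDo : IsOpen D) (hDc : IsPreconnected D)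
    {σ₀ : ℝ} (hσ₀ : 2 < σ₀) (hσD : ∀ᶠ z in 𝓝 ((σ₀ : ℝ) : ℂ), z ∈ D)
    (hEd : ∀ g, DifferentiableOn ℂ (fun z => Ec z g) D) (hEc : ∀ z ∈ D, Continuous (Ec z))
    (hEbd : ∀ z₀ ∈ D, ∀ K : Set (quasiSplit (↥(maximalRealSubfield L)) L (IsCMField.complexConj L) 3).Adelic, IsCompact K →
      ∃ V ∈ 𝓝 z₀, ∃ M : ℝ, ∀ z ∈ V, ∀ g ∈ K, ‖Ec z g‖ ≤ M)
    {s : ℂ → ℂ} (hs : DifferentiableOn ℂ s D)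
    (htube : ∀ z ∈ D, 2 < z.re → ∀ g : (quasiSplit (↥(maximalRealSubfield L)) L (IsCMField.complexConj L) 3).Adelic, ∫ y, ((h y : ℝ) : ℂ) * Ec z (g * y) ∂νG = s z * Ec z g) :
    ∀ z ∈ D, ∀ g : (quasiSplit (↥(maximalRealSubfield L)) L (IsCMField.complexConj L) 3).Adelic, ∫ y, ((h y : ℝ) : ℂ) * Ec z (g * y) ∂νG = s z * Ec z g := by
  intro z hz g
  -- the difference of the two sides is holomorphic on `D` and vanishes near `σ₀`
  set G : ℂ → ℂ := fun w => ∫ y, ((h y : ℝ) : ℂ) * Ec w (g * y) ∂νG - s w * Ec w g with hG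
  have hGd : DifferentiableOn ℂ G D := (differentiableOn_integral_mul_continued_cm_three L νG hhc hhs Ec hDo hEd hEc hEbd g).sub (hs.mul (hEd g))
  obtain ⟨ε, hε, hball⟩ := Metric.eventually_nhds_iff_ball.1 hσD
  have hσ₀D : ((σ₀ : ℝ) : ℂ) ∈ D := hball _ (Metric.mem_ball_self hε)
  have hseed : G =ᶠ[𝓝 ((σ₀ : ℝ) : ℂ)] 0 := by
    have hmem : Metric.ball ((σ₀ : ℝ) : ℂ) (min ε (σ₀ - 2)) ∈ 𝓝 ((σ₀ : ℝ) : ℂ) := Metric.ball_mem_nhds _ (lt_min hε (by linarith))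
    filter_upwards [hmem] with w hw
    rw [Metric.mem_ball] at hw
    have hwD : w ∈ D := hball _ (Metric.mem_ball.2 (hw.trans_le (min_le_left _ _)))
    have hw2 : 2 < w.re := by
      have h1 : |w.re - σ₀| ≤ dist w ((σ₀ : ℝ) : ℂ) := by
        rw [Complex.dist_eq]
        simpa only [Complex.sub_re, Complex.ofReal_re] using Complex.abs_re_le_norm (w - ((σ₀ : ℝ) : ℂ))
      have h2 := (abs_lt.1 (h1.trans_lt (hw.trans_le (min_le_right _ _)))).1
      linarith
    show G w = (0 : ℂ → ℂ) w
    rw [Pi.zero_apply, hG]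
    change ∫ y, ((h y : ℝ) : ℂ) * Ec w (g * y) ∂νG - s w * Ec w g = 0
    rw [htube w hwD hw2 g, sub_self]
  have h0 := (hGd.analyticOnNhd hDo).eqOn_zero_of_preconnected_of_eventuallyEq_zero hDc hσ₀D hseed hz
  rw [Pi.zero_apply, hG] at h0
  exact sub_eq_zero.1 h0

/-- **THE CONTINUED EIGEN-SMOOTHING IDENTITY OF AN EIGEN-SECTION** (§1 ∘ §2): `h ∈ C_c(G(𝔸))` real, `φ` continuous bounded with the eigen letter on the tube
`hact : ∀ z ∈ D, 2 < Re z → ∀ x, ∫ h(y)·f_z^φ(x y) dν_G = ŝ(z)·f_z^φ(x)`, `ŝ` holomorphic on `D`, continued values `Ec` with `hE2 : Ec z = E(f_z^φ)` on `D ∩ {2 < Re}` and the layer-2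
letters on `D` (open, preconnected, ∋ a neighbourhood of a real `σ₀ > 2`): **`∀ z ∈ D, ∀ g, ∫ h(y)·Ec z (g y) dν_G = ŝ(z)·Ec z g`** — the level replacement of the continued Hecke relation.
[cite: BernsteinLapid2019, §4 Claim 1 (pp. 9–10)] [cite: MoeglinWaldspurger1995, IV.1.9–IV.1.10] -/
theorem integral_mul_continued_eq_of_eigen_cm_three (νG : Measure (quasiSplit (↥(maximalRealSubfield L)) L (IsCMField.complexConj L) 3).Adelic) [νG.IsHaarMeasure]
    {h : (quasiSplit (↥(maximalRealSubfield L)) L (IsCMField.complexConj L) 3).Adelic → ℝ} (hhc : Continuous h) (hhs : HasCompactSupport h)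
    {φ : (quasiSplit (↥(maximalRealSubfield L)) L (IsCMField.complexConj L) 3).Adelic → ℂ} (hφc : Continuous φ) {M : ℝ} (hφM : ∀ x, ‖φ x‖ ≤ M)
    (Ec : ℂ → (quasiSplit (↥(maximalRealSubfield L)) L (IsCMField.complexConj L) 3).Adelic → ℂ) {D : Set ℂ} (hDo : IsOpen D) (hDc : IsPreconnected D)
    {σ₀ : ℝ} (hσ₀ : 2 < σ₀) (hσD : ∀ᶠ z in 𝓝 ((σ₀ : ℝ) : ℂ), z ∈ D)
    (hEd : ∀ g, DifferentiableOn ℂ (fun z => Ec z g) D) (hEc : ∀ z ∈ D, Continuous (Ec z))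
    (hEbd : ∀ z₀ ∈ D, ∀ K : Set (quasiSplit (↥(maximalRealSubfield L)) L (IsCMField.complexConj L) 3).Adelic, IsCompact K →
      ∃ V ∈ 𝓝 z₀, ∃ M : ℝ, ∀ z ∈ V, ∀ g ∈ K, ‖Ec z g‖ ≤ M)
    (hE2 : ∀ z ∈ D, 2 < z.re → Ec z = eisensteinSeriesU (flatSectionU φ z))
    {ŝ : ℂ → ℂ} (hŝ : DifferentiableOn ℂ ŝ D)
    (hact : ∀ z ∈ D, 2 < z.re → ∀ x : (quasiSplit (↥(maximalRealSubfield L)) L (IsCMField.complexConj L) 3).Adelic,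
      ∫ y, ((h y : ℝ) : ℂ) * flatSectionU φ z (x * y) ∂νG = ŝ z * flatSectionU φ z x) :
    ∀ z ∈ D, ∀ g : (quasiSplit (↥(maximalRealSubfield L)) L (IsCMField.complexConj L) 3).Adelic, ∫ y, ((h y : ℝ) : ℂ) * Ec z (g * y) ∂νG = ŝ z * Ec z g :=
  integral_mul_continued_eq_of_tube_cm_three L νG hhc hhs Ec hDo hDc hσ₀ hσD hEd hEc hEbd hŝ fun z hz hz2 g => by
    rw [hE2 z hz hz2]
    exact integral_mul_eisensteinSeriesU_eq_of_eigen_cm_three L νG (Complex.continuous_ofReal.comp hhc) (hhs.comp_left Complex.ofReal_zero) hφc hφM hz2 (hact z hz hz2) g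

end Continued

/-! ## §3 (B) at level: the pointwise bound near `z₀` from the `L²(μ)`-bound of the truncated family -/

section Pointwise

variable (μ : Measure (quasiSplit (↥(maximalRealSubfield L)) L (IsCMField.complexConj L) 3).automorphicQuotient) [(quasiSplit (↥(maximalRealSubfield L)) L (IsCMField.complexConj L) 3).IsAutomorphicMeasure μ]
  (νG : Measure (quasiSplit (↥(maximalRealSubfield L)) L (IsCMField.complexConj L) 3).Adelic) [νG.IsHaarMeasure] [νG.IsInvInvariant]

/-- **(B) AT LEVEL — «EVENTUAL `L²` BOUND ⇒ EVENTUAL POINTWISE BOUND»** in the operator-road currency.  Data: `h ∈ C_c(G(𝔸))` real; `s` continuous at `z₀` with `s(z₀) ≠ 0`; an eventual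
set of admissible parameters `S` (`∀ᶠ z in 𝓝[≠] z₀, z ∈ S`, e.g. `{1<Re} ∖ P`) on which `Ec z` is left-`G(F)`-invariant (`hEcinv`) and the smoothing identity `∫ h(y)·Ec z (g y) dν_G =
s(z)·Ec z g` holds (§2); `ν` Haar on `N(𝔸)` with a fundamental domain `𝓕` of `N(L⁺)`.  THEN for every `g` there is a threshold `T₀` (Godement's, on the compact `{g}·supp h`) such that for
every level `T ≥ T₀`, every `L²(μ)`-valued `Fam` with `⇑(Fam z) =ᵐ[μ] quotFun (Λ^T(Ec z))` on `S` and `‖Fam z‖ ≤ C` near `z₀` gives **`∃ C′, ∀ᶠ z in 𝓝[≠] z₀, ‖Ec z g‖ ≤ C′`**: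
`‖s(z)·Ec z g‖ = ‖∫ h(y)Ec z(gy)‖ ≤ C₀·‖quotFun (Λ^T(Ec z))‖_{L²(μ)} = C₀·‖Fam z‖` (★ `exists_bound_smoothing_truncation_of_isCompact`; invariance ★ `truncation_rational_mul`, `A_G·G(F) = G(F)` ★),
then ★ `eventually_norm_le_of_smul`. [cite: MoeglinWaldspurger1995, IV.3.12] [cite: BernsteinLapid2019, §4 p. 10] [cite: Garrett2018, §2.10] -/
theorem eventually_norm_le_of_smoothing_L2Family_cm_three
    (ν : Measure ↥(adelicUnipotent (↥(maximalRealSubfield L)) L (IsCMField.complexConj L) 3)) [ν.IsHaarMeasure]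
    {𝓕 : Set ↥(adelicUnipotent (↥(maximalRealSubfield L)) L (IsCMField.complexConj L) 3)}
    (h𝓕N : IsFundamentalDomain ↥(rationalUnipotent (↥(maximalRealSubfield L)) L (IsCMField.complexConj L) 3) 𝓕 ν)
    {h : (quasiSplit (↥(maximalRealSubfield L)) L (IsCMField.complexConj L) 3).Adelic → ℝ} (hhc : Continuous h) (hhs : HasCompactSupport h)
    {s : ℂ → ℂ} {z₀ : ℂ} (hsc : ContinuousAt s z₀) (hs0 : s z₀ ≠ 0)
    (Ec : ℂ → (quasiSplit (↥(maximalRealSubfield L)) L (IsCMField.complexConj L) 3).Adelic → ℂ) {S : Set ℂ} (hS : ∀ᶠ z in 𝓝[≠] z₀, z ∈ S)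
    (hEcinv : ∀ z ∈ S, ∀ (γ : (quasiSplit (↥(maximalRealSubfield L)) L (IsCMField.complexConj L) 3).arithmeticSubgroup) (x : (quasiSplit (↥(maximalRealSubfield L)) L (IsCMField.complexConj L) 3).Adelic),
      Ec z ((γ : (quasiSplit (↥(maximalRealSubfield L)) L (IsCMField.complexConj L) 3).Adelic) * x) = Ec z x)
    (hsmooth : ∀ z ∈ S, ∀ g : (quasiSplit (↥(maximalRealSubfield L)) L (IsCMField.complexConj L) 3).Adelic, ∫ y, ((h y : ℝ) : ℂ) * Ec z (g * y) ∂νG = s z * Ec z g)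
    (g : (quasiSplit (↥(maximalRealSubfield L)) L (IsCMField.complexConj L) 3).Adelic) :
    ∃ T₀ : ℝ≥0, ∀ T : ℝ≥0, T₀ ≤ T → ∀ (Fam : ℂ → (quasiSplit (↥(maximalRealSubfield L)) L (IsCMField.complexConj L) 3).L2 μ),
      (∀ z ∈ S, ((Fam z : (quasiSplit (↥(maximalRealSubfield L)) L (IsCMField.complexConj L) 3).L2 μ) : (quasiSplit (↥(maximalRealSubfield L)) L (IsCMField.complexConj L) 3).automorphicQuotient → ℂ) =ᵐ[μ]
        (quasiSplit (↥(maximalRealSubfield L)) L (IsCMField.complexConj L) 3).quotFun (truncation ν 𝓕 T (Ec z))) →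
      (∃ C : ℝ, ∀ᶠ z in 𝓝[≠] z₀, ‖Fam z‖ ≤ C) →
      ∃ C : ℝ, ∀ᶠ z in 𝓝[≠] z₀, ‖Ec z g‖ ≤ C := by
  obtain ⟨C₀, T₀, hC₀⟩ := exists_bound_smoothing_truncation_of_isCompact μ νG ν 𝓕 hhc hhs (isCompact_singleton (x := g))
  refine ⟨T₀, fun T hT Fam hFam hMS => ?_⟩
  obtain ⟨C, hC⟩ := hMS
  refine eventually_norm_le_of_smul hsc hs0 (B := max C₀ 0 * C) ?_
  filter_upwards [hS, hC] with z hzS hzC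
  -- the two inputs of the domination at level `T`: invariance and square-integrability of `Λ^T(Ec z)`
  have hG : ∀ γ ∈ (quasiSplit (↥(maximalRealSubfield L)) L (IsCMField.complexConj L) 3).quotientSubgroup, ∀ y, truncation ν 𝓕 T (Ec z) (γ * y) = truncation ν 𝓕 T (Ec z) y := by
    intro γ hγ y
    rw [quotientSubgroup_quasiSplit] at hγ
    exact truncation_rational_mul ν h𝓕N T (hEcinv z hzS) ⟨γ, hγ⟩ y
  have h2 : MemLp ((quasiSplit (↥(maximalRealSubfield L)) L (IsCMField.complexConj L) 3).quotFun (truncation ν 𝓕 T (Ec z))) 2 μ := (Lp.memLp (Fam z)).ae_eq (hFam z hzS)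
  have hnorm : (eLpNorm ((quasiSplit (↥(maximalRealSubfield L)) L (IsCMField.complexConj L) 3).quotFun (truncation ν 𝓕 T (Ec z))) 2 μ).toReal = ‖Fam z‖ := by
    rw [eLpNorm_congr_ae (hFam z hzS).symm, Lp.norm_def]
  have hb := hC₀ T hT g (Set.mem_singleton g) (Ec z) hG h2
  rw [hsmooth z hzS g, hnorm] at hb
  rw [smul_eq_mul]
  calc ‖s z * Ec z g‖ ≤ C₀ * ‖Fam z‖ := hb
    _ ≤ max C₀ 0 * ‖Fam z‖ := mul_le_mul_of_nonneg_right (le_max_left _ _) (norm_nonneg _)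
    _ ≤ max C₀ 0 * C := mul_le_mul_of_nonneg_left hzC (le_max_right _ _)

end Pointwise

/-! ## §4 (ED. 2) (B) at level, UNIFORM ON COMPACTS — the pole ledger's (B-P-K) currency -/

section Compact

variable (μ : Measure (quasiSplit (↥(maximalRealSubfield L)) L (IsCMField.complexConj L) 3).automorphicQuotient) [(quasiSplit (↥(maximalRealSubfield L)) L (IsCMField.complexConj L) 3).IsAutomorphicMeasure μ]
  (νG : Measure (quasiSplit (↥(maximalRealSubfield L)) L (IsCMField.complexConj L) 3).Adelic) [νG.IsHaarMeasure] [νG.IsInvInvariant]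

/-- **(B) AT LEVEL, UNIFORM ON A COMPACT `K`** — the ★ pole ledger's (B-P-K) inner clause (★ p863972 `hbddPK`, `∃ C, ∀ᶠ z in 𝓝[≠] z₀, ∀ g ∈ K, ‖Ec z g‖ ≤ C`): with the data of
`eventually_norm_le_of_smoothing_L2Family_cm_three` and a compact `K`, there is Godement's threshold `T₀` (of the compact `K·supp h`) such that for every level `T ≥ T₀` an `L²(μ)`-family `Fam`
a.e.-representing `Λ^T(Ec z)` on `S` with `‖Fam z‖ ≤ C` near `z₀` gives **ONE `C′` with `‖Ec z g‖ ≤ C′` for all `g ∈ K`, eventually near `z₀`** — the domination ★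
`exists_bound_smoothing_truncation_of_isCompact` is uniform on `K`, and `‖s z‖ ≥ ‖s z₀‖∕2` near `z₀`. [cite: MoeglinWaldspurger1995, IV.3.12] [cite: BernsteinLapid2019, §4 p. 10] [cite: Garrett2018, §2.10] -/
theorem eventually_forall_norm_le_of_smoothing_L2Family_cm_three
    (ν : Measure ↥(adelicUnipotent (↥(maximalRealSubfield L)) L (IsCMField.complexConj L) 3)) [ν.IsHaarMeasure]
    {𝓕 : Set ↥(adelicUnipotent (↥(maximalRealSubfield L)) L (IsCMField.complexConj L) 3)}
    (h𝓕N : IsFundamentalDomain ↥(rationalUnipotent (↥(maximalRealSubfield L)) L (IsCMField.complexConj L) 3) 𝓕 ν)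
    {h : (quasiSplit (↥(maximalRealSubfield L)) L (IsCMField.complexConj L) 3).Adelic → ℝ} (hhc : Continuous h) (hhs : HasCompactSupport h)
    {s : ℂ → ℂ} {z₀ : ℂ} (hsc : ContinuousAt s z₀) (hs0 : s z₀ ≠ 0)
    (Ec : ℂ → (quasiSplit (↥(maximalRealSubfield L)) L (IsCMField.complexConj L) 3).Adelic → ℂ) {S : Set ℂ} (hS : ∀ᶠ z in 𝓝[≠] z₀, z ∈ S)
    (hEcinv : ∀ z ∈ S, ∀ (γ : (quasiSplit (↥(maximalRealSubfield L)) L (IsCMField.complexConj L) 3).arithmeticSubgroup) (x : (quasiSplit (↥(maximalRealSubfield L)) L (IsCMField.complexConj L) 3).Adelic),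
      Ec z ((γ : (quasiSplit (↥(maximalRealSubfield L)) L (IsCMField.complexConj L) 3).Adelic) * x) = Ec z x)
    (hsmooth : ∀ z ∈ S, ∀ g : (quasiSplit (↥(maximalRealSubfield L)) L (IsCMField.complexConj L) 3).Adelic, ∫ y, ((h y : ℝ) : ℂ) * Ec z (g * y) ∂νG = s z * Ec z g)
    {K : Set (quasiSplit (↥(maximalRealSubfield L)) L (IsCMField.complexConj L) 3).Adelic} (hK : IsCompact K) :
    ∃ T₀ : ℝ≥0, ∀ T : ℝ≥0, T₀ ≤ T → ∀ (Fam : ℂ → (quasiSplit (↥(maximalRealSubfield L)) L (IsCMField.complexConj L) 3).L2 μ),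
      (∀ z ∈ S, ((Fam z : (quasiSplit (↥(maximalRealSubfield L)) L (IsCMField.complexConj L) 3).L2 μ) : (quasiSplit (↥(maximalRealSubfield L)) L (IsCMField.complexConj L) 3).automorphicQuotient → ℂ) =ᵐ[μ]
        (quasiSplit (↥(maximalRealSubfield L)) L (IsCMField.complexConj L) 3).quotFun (truncation ν 𝓕 T (Ec z))) →
      (∃ C : ℝ, ∀ᶠ z in 𝓝[≠] z₀, ‖Fam z‖ ≤ C) →
      ∃ C : ℝ, ∀ᶠ z in 𝓝[≠] z₀, ∀ g ∈ K, ‖Ec z g‖ ≤ C := by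
  obtain ⟨C₀, T₀, hC₀⟩ := exists_bound_smoothing_truncation_of_isCompact μ νG ν 𝓕 hhc hhs hK
  refine ⟨T₀, fun T hT Fam hFam hMS => ?_⟩
  obtain ⟨C, hC⟩ := hMS
  -- `‖s z‖ ≥ ‖s z₀‖ ∕ 2` near `z₀`
  have hpos : 0 < ‖s z₀‖ / 2 := by positivity
  have hnear : ∀ᶠ z in 𝓝 z₀, ‖s z₀‖ / 2 ≤ ‖s z‖ := by
    have h1 := hsc.norm.eventually (Ici_mem_nhds (show ‖s z₀‖ / 2 < ‖s z₀‖ by linarith [norm_pos_iff.2 hs0]))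
    filter_upwards [h1] with z hz using hz
  refine ⟨max C₀ 0 * C / (‖s z₀‖ / 2), ?_⟩
  filter_upwards [hS, hC, mem_nhdsWithin_of_mem_nhds hnear] with z hzS hzC hzs g hg
  have hG : ∀ γ ∈ (quasiSplit (↥(maximalRealSubfield L)) L (IsCMField.complexConj L) 3).quotientSubgroup, ∀ y, truncation ν 𝓕 T (Ec z) (γ * y) = truncation ν 𝓕 T (Ec z) y := by
    intro γ hγ y
    rw [quotientSubgroup_quasiSplit] at hγ
    exact truncation_rational_mul ν h𝓕N T (hEcinv z hzS) ⟨γ, hγ⟩ y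
  have h2 : MemLp ((quasiSplit (↥(maximalRealSubfield L)) L (IsCMField.complexConj L) 3).quotFun (truncation ν 𝓕 T (Ec z))) 2 μ := (Lp.memLp (Fam z)).ae_eq (hFam z hzS)
  have hnorm : (eLpNorm ((quasiSplit (↥(maximalRealSubfield L)) L (IsCMField.complexConj L) 3).quotFun (truncation ν 𝓕 T (Ec z))) 2 μ).toReal = ‖Fam z‖ := by
    rw [eLpNorm_congr_ae (hFam z hzS).symm, Lp.norm_def]
  have hb := hC₀ T hT g hg (Ec z) hG h2
  rw [hsmooth z hzS g, hnorm] at hb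
  have hB : ‖s z * Ec z g‖ ≤ max C₀ 0 * C :=
    calc ‖s z * Ec z g‖ ≤ C₀ * ‖Fam z‖ := hb
      _ ≤ max C₀ 0 * ‖Fam z‖ := mul_le_mul_of_nonneg_right (le_max_left _ _) (norm_nonneg _)
      _ ≤ max C₀ 0 * C := mul_le_mul_of_nonneg_left hzC (le_max_right _ _)
  rw [le_div_iff₀ hpos]
  calc ‖Ec z g‖ * (‖s z₀‖ / 2) ≤ ‖Ec z g‖ * ‖s z‖ := mul_le_mul_of_nonneg_left hzs (norm_nonneg _)
    _ = ‖s z * Ec z g‖ := by rw [norm_mul, mul_comm]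
    _ ≤ max C₀ 0 * C := hB

end Compact

end Summit.HodgeConjecture.HodgeConjecture.Cruxes.H413.K2E1EventualL2BoundPointwiseAtLevelCMThree

end
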